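import Mathlib
import HarnessLib

/-!
# `NoHeavyLowerTail` (stmt-CriticalPhenomena-4575), line fat-minority-linear — the two telescoping sums
# behind the `η log²(1/η)` rate of the first-pair bound

Route task `nh-dp-fatminority` (gen 4).  Pure real-variable lemmas (no probability) used to evaluate the
right-hand side of the first-pair Harris bound `…FatMinorityFirstPair.oneLayer_bad_le_firstPair`,
`Σ_x p_x Σ_c u_{x,c} min(η, D_x q_{x,c})` with `q_{x,c} = Π_{c'<c}(1 − u_{x,c'})`,
`D_x = Π_{y<x}(1 − p_y π_y)`, `π_y = 1 − Π_c(1 − u_{y,c})`: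

* `firstPair_fanSum_le_budget` — `Σ_c u_c min(η, D q_c) ≤ D · (1 − Π_c (1 − u_c))` (telescoping);
* `firstPair_fanSum_le_log` — if `D ≤ η e^L`, `L ≥ 0`, then `Σ_c u_c min(η, D q_c) ≤ η (L + 2)`
  (the pairs with `D q_c > η` have total weight `≤ L + 1` because `q ≤ e^{−Σ u}`; the rest telescope);
* `firstPair_unitSum_le` — if every unit with `p_x > 0` has `π_x ≥ π₀ > 0` and `e^{−Λ} ≤ η`, `Λ ≥ 0`, then
  `Σ_x p_x Σ_c u_{x,c} min(η, D_x q_{x,c}) ≤ η (1 + (Λ + 2)² / π₀)`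
  (potential `(Λ+2)² − (Λ+2−σ)²` in the fired attached mass `σ = Σ p_y π_y` while `σ ≤ Λ`, telescoping after).
All by `Finset.induction_on_max`.  No definitions.
-/

namespace Summit.CriticalPhenomena.PercolationContinuityZ3.Theorems

open scoped BigOperators
open Finset

noncomputable section

variable {n : ℕ}

/-- Inserting a new maximum does not change the strict lower sections of the old elements. [folklore] -/
theorem firstPair_filter_lt_insert_of_lt {s : Finset (Fin n)} {a c : Fin n} (hc : c ∈ s)
    (ha : ∀ x ∈ s, x < a) :
    (insert a s).filter (· < c) = s.filter (· < c) := by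
  ext y
  simp only [Finset.mem_filter, Finset.mem_insert]
  constructor
  · rintro ⟨hy | hy, hyc⟩
    · exact absurd (hy ▸ hyc) (not_lt.2 (ha c hc).le)
    · exact ⟨hy, hyc⟩
  · rintro ⟨hy, hyc⟩
    exact ⟨Or.inr hy, hyc⟩

/-- The strict lower section of a new maximum is the old set. [folklore] -/
theorem firstPair_filter_lt_insert_self {s : Finset (Fin n)} {a : Fin n} (ha : ∀ x ∈ s, x < a) :
    (insert a s).filter (· < a) = s := by
  ext y
  simp only [Finset.mem_filter, Finset.mem_insert]
  constructor
  · rintro ⟨hy | hy, hya⟩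
    · exact absurd (hy ▸ hya) (lt_irrefl _)
    · exact hy
  · intro hy
    exact ⟨Or.inr hy, ha y hy⟩

/-- **Fan sum, budget form**: for `u_c ∈ [0,1]`, `D ≥ 0`, `η ≥ 0`:
`Σ_c u_c min(η, D Π_{c'<c}(1−u_{c'})) ≤ D (1 − Π_c (1 − u_c))` (telescoping). [folklore] -/
theorem firstPair_fanSum_le_budget (A : Finset (Fin n)) (u : Fin n → ℝ)
    (hu0 : ∀ c ∈ A, 0 ≤ u c) (hu1 : ∀ c ∈ A, u c ≤ 1) (η D : ℝ) :
    ∑ c ∈ A, u c * min η (D * ∏ c' ∈ A.filter (· < c), (1 - u c')) ≤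
      D * (1 - ∏ c ∈ A, (1 - u c)) := by
  induction A using Finset.induction_on_max with
  | empty => simp
  | insert a s ha ih =>
    have has : a ∉ s := fun h => lt_irrefl a (ha a h)
    have hu0s : ∀ c ∈ s, 0 ≤ u c := fun c hc => hu0 c (Finset.mem_insert_of_mem hc)
    have hu1s : ∀ c ∈ s, u c ≤ 1 := fun c hc => hu1 c (Finset.mem_insert_of_mem hc)
    have ih' := ih hu0s hu1s
    rw [Finset.sum_insert has, Finset.prod_insert has, firstPair_filter_lt_insert_self ha]
    have hrest : ∑ c ∈ s, u c * min η (D * ∏ c' ∈ (insert a s).filter (· < c), (1 - u c')) =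
        ∑ c ∈ s, u c * min η (D * ∏ c' ∈ s.filter (· < c), (1 - u c')) :=
      Finset.sum_congr rfl fun c hc => by rw [firstPair_filter_lt_insert_of_lt hc ha]
    rw [hrest]
    set Q := ∏ c ∈ s, (1 - u c) with hQ
    have hQ0 : 0 ≤ Q := Finset.prod_nonneg fun c hc => sub_nonneg.2 (hu1s c hc)
    have hua0 := hu0 a (Finset.mem_insert_self a s)
    have h1 : u a * min η (D * Q) ≤ u a * (D * Q) :=
      mul_le_mul_of_nonneg_left (min_le_right _ _) hua0
    calc u a * min η (D * Q) + ∑ c ∈ s, u c * min η (D * ∏ c' ∈ s.filter (· < c), (1 - u c'))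
        ≤ u a * (D * Q) + D * (1 - Q) := add_le_add h1 ih'
      _ = D * (1 - (1 - u a) * Q) := by ring

/-- **Fan sum, logarithmic form**: for `u_c ∈ [0,1]`, `η > 0`, `L ≥ 0`, `0 ≤ D ≤ η e^L`:
`Σ_c u_c min(η, D Π_{c'<c}(1−u_{c'})) ≤ η (L + 2)`.  The pairs at which `D q > η` have total weight
`≤ L + 1` (since `q ≤ exp(−Σ u)`), the others telescope to `≤ η`. [folklore] -/
theorem firstPair_fanSum_le_log (A : Finset (Fin n)) (u : Fin n → ℝ)
    (hu0 : ∀ c ∈ A, 0 ≤ u c) (hu1 : ∀ c ∈ A, u c ≤ 1) (η D L : ℝ) (hη : 0 < η) (hL : 0 ≤ L)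
    (hD0 : 0 ≤ D) (hD : D ≤ η * Real.exp L) :
    ∑ c ∈ A, u c * min η (D * ∏ c' ∈ A.filter (· < c), (1 - u c')) ≤ η * (L + 2) := by
  -- invariant: `Σ_{c∈s} … ≤ η min(τ(s), L+1) + max 0 (η − D Q(s))`
  suffices h : ∑ c ∈ A, u c * min η (D * ∏ c' ∈ A.filter (· < c), (1 - u c')) ≤
      η * min (∑ c ∈ A, u c) (L + 1) + max 0 (η - D * ∏ c ∈ A, (1 - u c)) by
    refine h.trans ?_
    have h1 : η * min (∑ c ∈ A, u c) (L + 1) ≤ η * (L + 1) :=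
      mul_le_mul_of_nonneg_left (min_le_right _ _) hη.le
    have h2 : max 0 (η - D * ∏ c ∈ A, (1 - u c)) ≤ η := by
      refine max_le hη.le ?_
      have : 0 ≤ D * ∏ c ∈ A, (1 - u c) :=
        mul_nonneg hD0 (Finset.prod_nonneg fun c hc => sub_nonneg.2 (hu1 c hc))
      linarith
    linarith
  induction A using Finset.induction_on_max with
  | empty =>
    simp only [Finset.sum_empty, Finset.prod_empty, mul_one]
    have : 0 ≤ η * min 0 (L + 1) := by
      rw [min_eq_left (by linarith)]; simp
    linarith [le_max_left 0 (η - D)]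
  | insert a s ha ih =>
    have has : a ∉ s := fun h => lt_irrefl a (ha a h)
    have hu0s : ∀ c ∈ s, 0 ≤ u c := fun c hc => hu0 c (Finset.mem_insert_of_mem hc)
    have hu1s : ∀ c ∈ s, u c ≤ 1 := fun c hc => hu1 c (Finset.mem_insert_of_mem hc)
    have ih' := ih hu0s hu1s
    rw [Finset.sum_insert has, Finset.sum_insert has, Finset.prod_insert has,
      firstPair_filter_lt_insert_self ha]
    have hrest : ∑ c ∈ s, u c * min η (D * ∏ c' ∈ (insert a s).filter (· < c), (1 - u c')) =
        ∑ c ∈ s, u c * min η (D * ∏ c' ∈ s.filter (· < c), (1 - u c')) :=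
      Finset.sum_congr rfl fun c hc => by rw [firstPair_filter_lt_insert_of_lt hc ha]
    rw [hrest]
    set Q := ∏ c ∈ s, (1 - u c) with hQ
    set τ := ∑ c ∈ s, u c with hτ
    have hQ0 : 0 ≤ Q := Finset.prod_nonneg fun c hc => sub_nonneg.2 (hu1s c hc)
    have hua0 := hu0 a (Finset.mem_insert_self a s)
    have hua1 := hu1 a (Finset.mem_insert_self a s)
    have hτ0 : 0 ≤ τ := Finset.sum_nonneg hu0s
    -- `Q ≤ exp(-τ)`
    have hQexp : Q ≤ Real.exp (-τ) := by
      rw [hQ, hτ, ← Finset.sum_neg_distrib, Real.exp_sum]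
      refine Finset.prod_le_prod (fun c hc => sub_nonneg.2 (hu1s c hc)) fun c hc => ?_
      have := Real.add_one_le_exp (-u c)
      linarith
    by_cases hphase : η < D * Q
    · -- phase 1: the new pair is charged `η`; then `τ < L`
      have hτL : τ < L := by
        by_contra hcon
        push Not at hcon
        have h1 : Real.exp (-τ) ≤ Real.exp (-L) := Real.exp_le_exp.2 (by linarith)
        have h2 : D * Q ≤ η * Real.exp L * Real.exp (-L) :=
          mul_le_mul hD (hQexp.trans h1) hQ0 (by positivity)
        rw [mul_assoc, ← Real.exp_add, add_neg_cancel, Real.exp_zero, mul_one] at h2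
        linarith
      have hmin1 : min τ (L + 1) = τ := min_eq_left (by linarith)
      have hmin2 : min (u a + τ) (L + 1) = u a + τ := min_eq_left (by linarith)
      have hm : u a * min η (D * Q) ≤ u a * η := mul_le_mul_of_nonneg_left (min_le_left _ _) hua0
      -- the `max` term is monotone: `D (1-u a) Q ≤ D Q`
      have hmax : max 0 (η - D * Q) ≤ max 0 (η - D * ((1 - u a) * Q)) := by
        refine max_le_max le_rfl ?_
        have : D * ((1 - u a) * Q) ≤ D * Q := by
          refine mul_le_mul_of_nonneg_left ?_ hD0
          nlinarith
        linarith
      rw [hmin1] at ih'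
      rw [hmin2]
      linarith
    · -- phase 2: telescoping
      push Not at hphase
      have hm : u a * min η (D * Q) ≤ u a * (D * Q) :=
        mul_le_mul_of_nonneg_left (min_le_right _ _) hua0
      have hmax1 : max 0 (η - D * Q) = η - D * Q := max_eq_right (by linarith)
      have hmax2 : max 0 (η - D * ((1 - u a) * Q)) = η - D * ((1 - u a) * Q) := by
        refine max_eq_right ?_
        have : D * ((1 - u a) * Q) ≤ D * Q := by
          refine mul_le_mul_of_nonneg_left ?_ hD0
          nlinarith
        linarith
      have hmin : η * min τ (L + 1) ≤ η * min (u a + τ) (L + 1) :=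
        mul_le_mul_of_nonneg_left (min_le_min (by linarith) le_rfl) hη.le
      rw [hmax1] at ih'
      rw [hmax2]
      nlinarith [ih', hm, hmin]

/-- **Unit sum**: units `x ∈ U` with coins `p_x ∈ [0,1]`, pair weights `u_{x,c} ∈ [0,1]`
(`c ∈ A`), attachment `π_x = 1 − Π_c (1 − u_{x,c}) ≥ π₀ > 0` whenever `p_x > 0`; `η > 0`, `Λ ≥ 0`
with `e^{−Λ} ≤ η`.  Then with `D_x = Π_{y<x}(1 − p_y π_y)`, `q_{x,c} = Π_{c'<c}(1 − u_{x,c'})`: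
`Σ_x p_x Σ_c u_{x,c} min(η, D_x q_{x,c}) ≤ η (1 + (Λ + 2)² / π₀)`. [folklore] -/
theorem firstPair_unitSum_le (U A : Finset (Fin n)) (p : Fin n → ℝ) (u : Fin n → Fin n → ℝ)
    (hp0 : ∀ x ∈ U, 0 ≤ p x) (hp1 : ∀ x ∈ U, p x ≤ 1)
    (hu0 : ∀ x ∈ U, ∀ c ∈ A, 0 ≤ u x c) (hu1 : ∀ x ∈ U, ∀ c ∈ A, u x c ≤ 1)
    (η Λ π₀ : ℝ) (hη : 0 < η) (hΛ : 0 ≤ Λ) (hηΛ : Real.exp (-Λ) ≤ η) (hπ₀ : 0 < π₀)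
    (hπ : ∀ x ∈ U, 0 < p x → π₀ ≤ 1 - ∏ c ∈ A, (1 - u x c)) :
    ∑ x ∈ U, p x * ∑ c ∈ A, u x c *
        min η ((∏ y ∈ U.filter (· < x), (1 - p y * (1 - ∏ c ∈ A, (1 - u y c)))) *
          ∏ c' ∈ A.filter (· < c), (1 - u x c')) ≤
      η * (1 + (Λ + 2) ^ 2 / π₀) := by
  -- attachment probabilities
  set π : Fin n → ℝ := fun x => 1 - ∏ c ∈ A, (1 - u x c) with hπdef
  have hπ0 : ∀ x ∈ U, 0 ≤ π x := fun x hx => by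
    have : ∏ c ∈ A, (1 - u x c) ≤ 1 :=
      Finset.prod_le_one (fun c hc => sub_nonneg.2 (hu1 x hx c hc)) fun c hc => by
        linarith [hu0 x hx c hc]
    simp only [hπdef]; linarith
  have hπ1 : ∀ x ∈ U, π x ≤ 1 := fun x hx => by
    have : 0 ≤ ∏ c ∈ A, (1 - u x c) := Finset.prod_nonneg fun c hc => sub_nonneg.2 (hu1 x hx c hc)
    simp only [hπdef]; linarith
  -- invariant over `s ⊆ U`: total ≤ (η/π₀) P(min(σ(s), Λ+1)) + max 0 (η − D(s)),
  -- P(σ) = (Λ+2)² − (Λ+2−σ)², σ(s) = Σ_{y∈s} p_y π_y, D(s) = Π_{y∈s} (1 − p_y π_y).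
  suffices h : ∀ s : Finset (Fin n), s ⊆ U →
      ∑ x ∈ s, p x * ∑ c ∈ A, u x c *
          min η ((∏ y ∈ s.filter (· < x), (1 - p y * π y)) * ∏ c' ∈ A.filter (· < c), (1 - u x c')) ≤
        (η / π₀) * ((Λ + 2) ^ 2 - (Λ + 2 - min (∑ y ∈ s, p y * π y) (Λ + 1)) ^ 2) +
          max 0 (η - ∏ y ∈ s, (1 - p y * π y)) by
    have hU := h U subset_rfl
    refine hU.trans ?_
    have h1 : (Λ + 2) ^ 2 - (Λ + 2 - min (∑ y ∈ U, p y * π y) (Λ + 1)) ^ 2 ≤ (Λ + 2) ^ 2 := by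
      nlinarith [sq_nonneg (Λ + 2 - min (∑ y ∈ U, p y * π y) (Λ + 1))]
    have h2 : max 0 (η - ∏ y ∈ U, (1 - p y * π y)) ≤ η := by
      refine max_le hη.le ?_
      have : 0 ≤ ∏ y ∈ U, (1 - p y * π y) := Finset.prod_nonneg fun y hy => by
        have := mul_le_one₀ (hp1 y hy) (hπ0 y hy) (hπ1 y hy); linarith
      linarith
    have h3 : (η / π₀) * ((Λ + 2) ^ 2 - (Λ + 2 - min (∑ y ∈ U, p y * π y) (Λ + 1)) ^ 2) ≤
        (η / π₀) * (Λ + 2) ^ 2 := mul_le_mul_of_nonneg_left h1 (div_nonneg hη.le hπ₀.le)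
    have : η * (1 + (Λ + 2) ^ 2 / π₀) = (η / π₀) * (Λ + 2) ^ 2 + η := by
      field_simp; ring
    linarith
  intro s hs
  induction s using Finset.induction_on_max with
  | empty =>
    simp only [Finset.sum_empty, Finset.prod_empty]
    rw [min_eq_left (by linarith)]
    have : max 0 (η - 1) ≥ 0 := le_max_left _ _
    nlinarith [div_nonneg hη.le hπ₀.le]
  | insert a s ha ih =>
    have has : a ∉ s := fun h => lt_irrefl a (ha a h)
    have hsU : s ⊆ U := fun y hy => hs (Finset.mem_insert_of_mem hy)
    have haU : a ∈ U := hs (Finset.mem_insert_self a s)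
    have ih' := ih hsU
    rw [Finset.sum_insert has, Finset.sum_insert has, Finset.prod_insert has,
      firstPair_filter_lt_insert_self ha]
    have hrest : ∑ x ∈ s, p x * ∑ c ∈ A, u x c *
        min η ((∏ y ∈ (insert a s).filter (· < x), (1 - p y * π y)) *
          ∏ c' ∈ A.filter (· < c), (1 - u x c')) =
        ∑ x ∈ s, p x * ∑ c ∈ A, u x c *
        min η ((∏ y ∈ s.filter (· < x), (1 - p y * π y)) * ∏ c' ∈ A.filter (· < c), (1 - u x c')) :=
      Finset.sum_congr rfl fun x hx => by rw [firstPair_filter_lt_insert_of_lt hx ha]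
    rw [hrest]
    set D := ∏ y ∈ s, (1 - p y * π y) with hD
    set σ := ∑ y ∈ s, p y * π y with hσ
    have hpa0 := hp0 a haU
    have hpa1 := hp1 a haU
    have hπa0 := hπ0 a haU
    have hπa1 := hπ1 a haU
    have hD0 : 0 ≤ D := Finset.prod_nonneg fun y hy => by
      have := mul_le_one₀ (hp1 y (hsU hy)) (hπ0 y (hsU hy)) (hπ1 y (hsU hy)); linarith
    have hσ0 : 0 ≤ σ := Finset.sum_nonneg fun y hy => mul_nonneg (hp0 y (hsU hy)) (hπ0 y (hsU hy))
    have hDexp : D ≤ Real.exp (-σ) := by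
      rw [hD, hσ, ← Finset.sum_neg_distrib, Real.exp_sum]
      refine Finset.prod_le_prod (fun y hy => ?_) fun y hy => ?_
      · have := mul_le_one₀ (hp1 y (hsU hy)) (hπ0 y (hsU hy)) (hπ1 y (hsU hy)); linarith
      · have := Real.add_one_le_exp (-(p y * π y)); linarith
    have hpπ1 : p a * π a ≤ 1 := mul_le_one₀ hpa1 hπa0 hπa1
    have hpπ0 : 0 ≤ p a * π a := mul_nonneg hpa0 hπa0
    -- the new unit's fan sum, two regimes
    set Fa := ∑ c ∈ A, u a c * min η (D * ∏ c' ∈ A.filter (· < c), (1 - u a c')) with hFa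
    have hFa_budget : Fa ≤ D * π a :=
      firstPair_fanSum_le_budget A (u a) (hu0 a haU) (hu1 a haU) η D
    have hmaxmono : max 0 (η - D) ≤ max 0 (η - (1 - p a * π a) * D) := by
      refine max_le_max le_rfl ?_
      nlinarith
    by_cases hphase : σ ≤ Λ
    · -- phase 1: `D ≤ e^{-σ} ≤ η e^{Λ - σ}`, fan sum ≤ η (Λ - σ + 2), absorbed by the potential
      have hDle : D ≤ η * Real.exp (Λ - σ) := by
        have h1 : Real.exp (-σ) = Real.exp (-Λ) * Real.exp (Λ - σ) := by
          rw [← Real.exp_add]; ring_nf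
        rw [h1] at hDexp
        exact hDexp.trans (mul_le_mul_of_nonneg_right hηΛ (Real.exp_pos _).le)
      have hFa_log : Fa ≤ η * (Λ - σ + 2) :=
        firstPair_fanSum_le_log A (u a) (hu0 a haU) (hu1 a haU) η D (Λ - σ) hη (by linarith) hD0 hDle
      have hmin1 : min σ (Λ + 1) = σ := min_eq_left (by linarith)
      have hmin2 : min (p a * π a + σ) (Λ + 1) = p a * π a + σ := min_eq_left (by linarith)
      rw [hmin1] at ih'
      rw [hmin2]
      -- potential increment ≥ π₀ p_a (Λ + 2 - σ) ≥ what the fan sum costs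
      by_cases hpa : 0 < p a
      · have hπa := hπ a haU hpa
        have hkey : p a * (η * (Λ - σ + 2)) ≤
            (η / π₀) * ((Λ + 2 - σ) ^ 2 - (Λ + 2 - (p a * π a + σ)) ^ 2) := by
          rw [div_mul_eq_mul_div, le_div_iff₀ hπ₀]
          have h1 : (Λ + 2 - σ) ^ 2 - (Λ + 2 - (p a * π a + σ)) ^ 2 =
              p a * π a * (2 * (Λ + 2 - σ) - p a * π a) := by ring
          rw [h1]
          have h2 : π₀ * (Λ - σ + 2) ≤ π a * (2 * (Λ + 2 - σ) - p a * π a) := by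
            nlinarith
          have h3 : p a * (η * (Λ - σ + 2)) * π₀ = η * (p a * (π₀ * (Λ - σ + 2))) := by ring
          rw [h3]
          have h4 : η * (p a * π a * (2 * (Λ + 2 - σ) - p a * π a)) =
              η * (p a * (π a * (2 * (Λ + 2 - σ) - p a * π a))) := by ring
          rw [h4]
          exact mul_le_mul_of_nonneg_left (mul_le_mul_of_nonneg_left h2 hpa.le) hη.le
        have hFa' : p a * Fa ≤ p a * (η * (Λ - σ + 2)) := mul_le_mul_of_nonneg_left hFa_log hpa.le
        nlinarith [ih', hFa', hkey, hmaxmono]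
      · have hpa' : p a = 0 := le_antisymm (not_lt.1 hpa) hpa0
        simp only [hpa', zero_mul, zero_add, one_mul, sub_zero] at ih' hmaxmono ⊢
        linarith
    · -- phase 2: `D ≤ e^{-σ} < e^{-Λ} ≤ η`, telescoping
      push Not at hphase
      have hDη : D ≤ η := by
        have : Real.exp (-σ) ≤ Real.exp (-Λ) := Real.exp_le_exp.2 (by linarith)
        linarith [hDexp]
      have hmax1 : max 0 (η - D) = η - D := max_eq_right (by linarith)
      have hmax2 : max 0 (η - (1 - p a * π a) * D) = η - (1 - p a * π a) * D := by
        refine max_eq_right ?_; nlinarith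
      have hminmono : (Λ + 2) ^ 2 - (Λ + 2 - min σ (Λ + 1)) ^ 2 ≤
          (Λ + 2) ^ 2 - (Λ + 2 - min (p a * π a + σ) (Λ + 1)) ^ 2 := by
        have hm1 : min σ (Λ + 1) ≤ min (p a * π a + σ) (Λ + 1) := min_le_min (by linarith) le_rfl
        have hm2 : min (p a * π a + σ) (Λ + 1) ≤ Λ + 1 := min_le_right _ _
        have hm0 : 0 ≤ min σ (Λ + 1) := le_min hσ0 (by linarith)
        nlinarith
      have hcoef : 0 ≤ η / π₀ := div_nonneg hη.le hπ₀.le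
      rw [hmax1] at ih'
      rw [hmax2]
      have hFa' : p a * Fa ≤ p a * (D * π a) := mul_le_mul_of_nonneg_left hFa_budget hpa0
      have hP := mul_le_mul_of_nonneg_left hminmono hcoef
      have e1 : p a * (D * π a) = p a * π a * D := by ring
      have e2 : η - (1 - p a * π a) * D = (η - D) + p a * π a * D := by ring
      rw [e2]
      rw [e1] at hFa'
      linarith [ih', hFa', hP]

end

end Summit.CriticalPhenomena.PercolationContinuityZ3.Theorems
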